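import Literature.AlgebraicGeometry.Frobenioids.PrimesEquivalence
import Literature.AlgebraicGeometry.Frobenioids.DivFrobeniusTrivialTransport
import HarnessLib

/-!
# [FrdI] Theorem 4.2 (i), proof step «it suffices to do so after passing to the perfections» (S5 row T42-L03)

Mochizuki, *The geometry of Frobenioids I: the general theory*, Kyushu J. Math. **62** (2008)
293–400, §4, Theorem 4.2 (i), proof p. 78 ll. 40–46 (render `paper:url-bbf705efa10f`, read on the page)
[cite: MochizukiFrdI2008, Thm. 4.2 (i) p.78]:

> "Moreover, to prove the remainder of assertion (i) [i.e., that `Ψ` preserves primary steps and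
> Div-identity endomorphisms] and assertions (ii), (iii), clearly it suffices to do so after passing
> to the perfections of the `C_i` [cf. Theorem 3.4, (iii)]; thus, for the remainder of the proof of
> Theorem 4.2, we may assume, without loss of generality, that the `C_i` are of perfect type [cf. also
> Proposition 5.5, (iii), below]."

PROOF-ONLY file (sub-DAG `plan/L1/SUBDAG-FrdI-Thm42-Thm49.md`, row `FrdI:Thm4.2(i)/T42-L03`
`PerfectWLOG`; statements file `Thm42Sub.lean`, seat abc-iut-L1-t14; this file = MENU row M4b of the L1
lead's ruling R68). Two parts; this file is part (A).

(A) The FORMAL TRANSPORT PRINCIPLE behind "clearly it suffices", in exactly the shape of the named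
statement `FrdI.T42.PerfectWLOG` (`perfectWLOG_transport` has that statement as its type, binder for
binder): for functors `P_i : C_i → C_i'`, an equivalence `Ψ'` with a 1-commutation `P₁ ⋙ Ψ' ≅ Ψ ⋙ P₂`
[the square of Theorem 3.4, (iii)], and `P_i` PRESERVING AND REFLECTING primary pre-steps and
Div-identity endomorphisms, preservation by `Ψ'` implies preservation by `Ψ`. Used: naturality of the
commutation isomorphism (`(Ψ ⋙ P₂)(φ) = e⁻¹ ≫ (P₁ ⋙ Ψ')(φ) ≫ e`) and invariance of primary pre-steps /
Div-identity endomorphisms under composition / conjugation with isomorphisms in a pre-Frobenioid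
(`IsPrimaryPreStep.iso_comp/comp_iso`, `IsDivIdentity.conj`, tree). The auxiliary lemmas
`isPrimaryPreStep_map_of_square` / `isDivIdentity_map_of_square` allow the target pre-Frobenioids
`C_i' → F_{Φ_i'}` to live over divisor monoids `Φ_i'` different from `Φ_i` (as `C^pf → F_{Φ^pf}` does);
the named statement pins `Φ_i' = Φ_i` and is the special case.

(B) The instantiation AT THE PERFECTIONS of the tree (`C → C^pf` preserves and reflects primary pre-steps and
Div-identity endomorphisms; the reduction of Thm. 4.2 (i) to `Ψ^pf`) is the companion file
`Thm42PerfectionReduction.lean` (imports the perfection square `PerfectionFunctoriality.lean`).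
Composition is diagrammatic; monoids multiplicative. No new definitions; nothing of the paper is
asserted beyond what is proved.
-/

namespace Literature.AlgebraicGeometry.Frobenioids

open CategoryTheory Opposite

namespace FrdI.T42

universe w v v' u u'

section Transport

universe wa va va' ua ua' wb vb vb' ub ub' wc vc vc' uc uc' wd vd vd' ud ud'

/- Four pre-Frobenioid structures over four (possibly different) divisor-monoid functors: the sources
`C_i → F_{Φ_i}` and the targets `C_i' → F_{Φ_i'}` of the functors `P_i` (for the perfections,
`Φ_i' = Φ_i^pf`). -/
variable {D₁ : Type ua} [Category.{va} D₁] {Φ₁ : D₁ᵒᵖ ⥤ CommMonCat.{wa}} {C₁ : Type ua'} [Category.{va'} C₁]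
  {D₂ : Type ub} [Category.{vb} D₂] {Φ₂ : D₂ᵒᵖ ⥤ CommMonCat.{wb}} {C₂ : Type ub'} [Category.{vb'} C₂]
  {D₁' : Type uc} [Category.{vc} D₁'] {Φ₁' : D₁'ᵒᵖ ⥤ CommMonCat.{wc}} {C₁' : Type uc'} [Category.{vc'} C₁']
  {D₂' : Type ud} [Category.{vd} D₂'] {Φ₂' : D₂'ᵒᵖ ⥤ CommMonCat.{wd}} {C₂' : Type ud'} [Category.{vd'} C₂']
  {F₁ : C₁ ⥤ ElemFrobenioid Φ₁} {F₂ : C₂ ⥤ ElemFrobenioid Φ₂} {F₁' : C₁' ⥤ ElemFrobenioid Φ₁'}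
  {F₂' : C₂' ⥤ ElemFrobenioid Φ₂'} {Ψ : C₁ ≌ C₂} {Ψ' : C₁' ≌ C₂'} {P₁ : C₁ ⥤ C₁'} {P₂ : C₂ ⥤ C₂'}

/-- The commutation isomorphism `e : P₁ ⋙ Ψ' ≅ Ψ ⋙ P₂` exhibits `P₂(Ψ(φ))` as the conjugate
`e⁻¹_X ∘ Ψ'(P₁(φ)) ∘ e_Y` (naturality of `e`). [cite: MochizukiFrdI2008, Thm. 4.2 (i) p.78] -/
theorem map_map_eq_conj (e : P₁ ⋙ Ψ'.functor ≅ Ψ.functor ⋙ P₂) {X Y : C₁} (φ : X ⟶ Y) :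
    P₂.map (Ψ.functor.map φ) = (e.app X).inv ≫ Ψ'.functor.map (P₁.map φ) ≫ (e.app Y).hom := by
  have h := NatIso.naturality_1 e φ
  simp only [Functor.comp_map] at h
  exact h.symm

/-- **Transport of primary pre-steps** (p. 78 ll. 40–46): if `P₁` preserves primary pre-steps, `P₂`
reflects them (in a pre-Frobenioid `C₂'`), `Ψ'` preserves them and `P₁ ⋙ Ψ' ≅ Ψ ⋙ P₂`, then `Ψ`
preserves primary pre-steps. [cite: MochizukiFrdI2008, Thm. 4.2 (i) p.78] -/
theorem isPrimaryPreStep_map_of_square (e : P₁ ⋙ Ψ'.functor ≅ Ψ.functor ⋙ P₂)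
    (hP₂' : IsPreFrobenioid Φ₂' F₂')
    (h₁ : ∀ ⦃X Y : C₁⦄ (φ : X ⟶ Y), PreFrobenioid.IsPrimaryPreStep F₁ φ →
      PreFrobenioid.IsPrimaryPreStep F₁' (P₁.map φ))
    (h₂ : ∀ ⦃X Y : C₂⦄ (φ : X ⟶ Y), PreFrobenioid.IsPrimaryPreStep F₂' (P₂.map φ) →
      PreFrobenioid.IsPrimaryPreStep F₂ φ)
    (hΨ' : ∀ ⦃X Y : C₁'⦄ (φ : X ⟶ Y), PreFrobenioid.IsPrimaryPreStep F₁' φ →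
      PreFrobenioid.IsPrimaryPreStep F₂' (Ψ'.functor.map φ))
    ⦃X Y : C₁⦄ (φ : X ⟶ Y) (hφ : PreFrobenioid.IsPrimaryPreStep F₁ φ) :
    PreFrobenioid.IsPrimaryPreStep F₂ (Ψ.functor.map φ) := by
  apply h₂
  rw [map_map_eq_conj e φ]
  exact ((hΨ' _ (h₁ φ hφ)).comp_iso hP₂' (e.app Y).hom).iso_comp hP₂' (e.app X).inv

/-- **Transport of Div-identity endomorphisms** (p. 78 ll. 40–46): if `P₁` preserves Div-identity
endomorphisms, `P₂` reflects them, `Ψ'` preserves them and `P₁ ⋙ Ψ' ≅ Ψ ⋙ P₂`, then `Ψ` preserves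
Div-identity endomorphisms. [cite: MochizukiFrdI2008, Thm. 4.2 (i) p.78] -/
theorem isDivIdentity_map_of_square (e : P₁ ⋙ Ψ'.functor ≅ Ψ.functor ⋙ P₂)
    (h₁ : ∀ ⦃X : C₁⦄ (α : X ⟶ X), PreFrobenioid.IsDivIdentity F₁ α →
      PreFrobenioid.IsDivIdentity F₁' (P₁.map α))
    (h₂ : ∀ ⦃X : C₂⦄ (α : X ⟶ X), PreFrobenioid.IsDivIdentity F₂' (P₂.map α) →
      PreFrobenioid.IsDivIdentity F₂ α)
    (hΨ' : ∀ ⦃X : C₁'⦄ (α : X ⟶ X), PreFrobenioid.IsDivIdentity F₁' α →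
      PreFrobenioid.IsDivIdentity F₂' (Ψ'.functor.map α))
    ⦃X : C₁⦄ (α : X ⟶ X) (hα : PreFrobenioid.IsDivIdentity F₁ α) :
    PreFrobenioid.IsDivIdentity F₂ (Ψ.functor.map α) := by
  apply h₂
  rw [map_map_eq_conj e α]
  exact (hΨ' _ (h₁ α hα)).conj (e.app X)

end Transport

/-- **T42-L03 `PerfectWLOG` — the transport principle, PROVED** in exactly the shape of the named
statement `FrdI.T42.PerfectWLOG` of `Thm42Sub.lean`. Print, p. 78 ll. 41–47: "Moreover, to prove the
remainder of assertion (i) [i.e., that `Ψ` preserves primary steps and Div-identity endomorphisms] and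
assertions (ii), (iii), clearly it suffices to do so after passing to the perfections of the `C_i`
[cf. Theorem 3.4, (iii)]; thus, for the remainder of the proof of Theorem 4.2, we may assume, without loss
of generality, that the `C_i` are of perfect type [cf. also Proposition 5.5, (iii), below]." (paraphrase, our
reading of these lines, NOT a quoted sentence: it suffices to treat the perfect case; the transfer of
primary steps / Div-identity endomorphisms along `C → C^pf` — that this functor preserves and reflects
them — is OUR lemma chain, `Thm42PerfectionReduction.lean` (p413089), and is what the hypotheses below
abstract). Statement: for functors `P_i : C_i → C_i'`, an equivalence `Ψ'` with `P₁ ⋙ Ψ' ≅ Ψ ⋙ P₂`, and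
`P_i` preserving and reflecting primary pre-steps and Div-identity endomorphisms, preservation by `Ψ'`
implies preservation by `Ψ` (both clauses). The hypothesis `IsPreFrobenioid Φ₂ F₂` of the named
statement is not needed and is ignored. [cite: MochizukiFrdI2008, Thm. 4.2 (i) p.78] -/
theorem perfectWLOG_transport :
    ∀ {D₁ : Type u} [Category.{v} D₁] {Φ₁ : D₁ᵒᵖ ⥤ CommMonCat.{w}} {C₁ : Type u'} [Category.{v'} C₁]
    {D₂ : Type u} [Category.{v} D₂] {Φ₂ : D₂ᵒᵖ ⥤ CommMonCat.{w}} {C₂ : Type u'} [Category.{v'} C₂]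
    {C₁' : Type u'} [Category.{v'} C₁'] {C₂' : Type u'} [Category.{v'} C₂']
    (F₁ : C₁ ⥤ ElemFrobenioid Φ₁) (F₂ : C₂ ⥤ ElemFrobenioid Φ₂) (F₁' : C₁' ⥤ ElemFrobenioid Φ₁)
    (F₂' : C₂' ⥤ ElemFrobenioid Φ₂) (Ψ : C₁ ≌ C₂) (Ψ' : C₁' ≌ C₂') (P₁ : C₁ ⥤ C₁') (P₂ : C₂ ⥤ C₂'),
    Nonempty (P₁ ⋙ Ψ'.functor ≅ Ψ.functor ⋙ P₂) →
    IsPreFrobenioid Φ₂ F₂ → IsPreFrobenioid Φ₂ F₂' →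
    (∀ ⦃X Y : C₁⦄ (φ : X ⟶ Y), PreFrobenioid.IsPrimaryPreStep F₁ φ ↔
        PreFrobenioid.IsPrimaryPreStep F₁' (P₁.map φ)) →
    (∀ ⦃X Y : C₂⦄ (φ : X ⟶ Y), PreFrobenioid.IsPrimaryPreStep F₂ φ ↔
        PreFrobenioid.IsPrimaryPreStep F₂' (P₂.map φ)) →
    (∀ ⦃X : C₁⦄ (α : X ⟶ X), PreFrobenioid.IsDivIdentity F₁ α ↔ PreFrobenioid.IsDivIdentity F₁' (P₁.map α)) →
    (∀ ⦃X : C₂⦄ (α : X ⟶ X), PreFrobenioid.IsDivIdentity F₂ α ↔ PreFrobenioid.IsDivIdentity F₂' (P₂.map α)) →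
      ((∀ ⦃X Y : C₁'⦄ (φ : X ⟶ Y), PreFrobenioid.IsPrimaryPreStep F₁' φ →
          PreFrobenioid.IsPrimaryPreStep F₂' (Ψ'.functor.map φ)) →
        ∀ ⦃X Y : C₁⦄ (φ : X ⟶ Y), PreFrobenioid.IsPrimaryPreStep F₁ φ →
          PreFrobenioid.IsPrimaryPreStep F₂ (Ψ.functor.map φ)) ∧
      ((∀ ⦃X : C₁'⦄ (α : X ⟶ X), PreFrobenioid.IsDivIdentity F₁' α →
          PreFrobenioid.IsDivIdentity F₂' (Ψ'.functor.map α)) →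
        ∀ ⦃X : C₁⦄ (α : X ⟶ X), PreFrobenioid.IsDivIdentity F₁ α →
          PreFrobenioid.IsDivIdentity F₂ (Ψ.functor.map α)) := by
  intro D₁ _ Φ₁ C₁ _ D₂ _ Φ₂ C₂ _ C₁' _ C₂' _ F₁ F₂ F₁' F₂' Ψ Ψ' P₁ P₂ he _ hP₂' hp₁ hp₂ hd₁ hd₂
  obtain ⟨e⟩ := he
  exact ⟨fun hΨ' => isPrimaryPreStep_map_of_square e hP₂' (fun _ _ φ h => (hp₁ φ).mp h)
      (fun _ _ φ h => (hp₂ φ).mpr h) hΨ',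
    fun hΨ' => isDivIdentity_map_of_square e (fun _ α h => (hd₁ α).mp h)
      (fun _ α h => (hd₂ α).mpr h) hΨ'⟩

end FrdI.T42

end Literature.AlgebraicGeometry.Frobenioids
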